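import Summits.PneNP.PneNP.Theorems.SoloInformedResBoundNPCheck
import Summits.PneNP.PneNP.Theorems.SoloInformedResBoundUncond
import Literature.Computability.Complexity.CodeFPBudgets
import Literature.Computability.Complexity.LengthCompare
import Literature.Computability.Complexity.AOWListMatrixFP
import HarnessLib

/-!
# `RESBOUND ∈ NP`, hence `RESBOUND` is NP-complete and `PneNP ↔ RESBOUND ∉ P` unconditionally

Soloist file (`solo-PneNP-informed`; landing prefix `SoloInformed`), second half of `RESBOUND ∈ NP`:
the checker `SoloResNP.refB` of `SoloInformedResBoundNPCheck.lean` is a typed polynomial-time program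
(`refFP`, in the tree's `CodeFP` calculus), so the verifier language
`R = {⟨x, y⟩ : x = ⟨code F, w⟩ is a pair code with canonical CNF part, and the CNF decoded from y
codes a refutation of F with ≤ |w| lines}` is in `P` (`resVerLang_mem_P`, read through the tree's TOTAL
decoder `decCNF`/`canonCNFFn ∈ FP` [KSATReductions]); with the cubic witness bound this is a
polynomial verifier for `RESBOUND` (`isPolyVerifierFor_resBound`), so **`resBoundLang ∈ NP`**
(`soloInformed_resBound_mem_NP`) — the routine half of [Atserias–Müller 2020, Thm 1]. Consequences
with the tree's unconditional hardness (`SoloInformedResBoundUncond.lean`): **`RESBOUND` is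
NP-complete** and **`PneNP ↔ RESBOUND ∉ P`** with no hypothesis left (`soloInformed_pneNP_iff_resBound`).
Refs: A. Atserias, M. Müller, *Automating Resolution is NP-hard*, J. ACM 67(5) (2020) Art. 31, §1,
Thm 1; S. A. Cook, R. A. Reckhow, J. Symb. Logic 44 (1979), Def. 1.4; S. Arora, B. Barak,
*Computational Complexity* (2009), Def. 2.1, Thm 2.8 [AroraBarakCC2009].
-/

namespace Summit.PneNP.PneNP.Theorems

open Literature.Computability.Complexity Literature.Computability.MetaComplexity
open _root_.Computability Literature.Computability.Complexity.CodeFP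
open Literature.Computability.Complexity.Brick (fstF sndF fstF_boolPair sndF_boolPair fstF_mem_FP sndF_mem_FP)
open Literature.Computability.Complexity.Expander.E3LC (cnfE cnfE_eq litE rawClausesFP)

namespace SoloResNP

/-! ### Size of the projected witness -/

/-- **The witness** of a refutation: the line codes of its projection. [folklore] -/
noncomputable def witness (F : CNF ℕ) (π : List (ResLine ℕ)) : CNF ℕ := (π.map (projL F)).map encLine

/-- The checker accepts the witness of a refutation. [cite: CookReckhow1979, Def. 1.4] -/
theorem refB_witness {F : CNF ℕ} {s : ℕ} {π : List (ResLine ℕ)} (hπ : IsResRefutation F π)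
    (hs : π.length ≤ s) : refB F s (witness F π) = true :=
  refB_map_encLine (isResRefutation_map_proj hπ) (by rw [List.length_map]; exact hs)

/-- A projected clause has at most `2·|vars F|` literals. [folklore] -/
theorem card_projC_le (F : CNF ℕ) (C : Finset (Literal ℕ)) : (projC F C).card ≤ 2 * F.vars.card :=
  calc (projC F C).card ≤ (F.vars ×ˢ (Finset.univ : Finset Bool)).card :=
        Finset.card_le_card fun l hl => Finset.mem_product.2 ⟨(Finset.mem_filter.1 hl).2, Finset.mem_univ _⟩
    _ = 2 * F.vars.card := by simp [Finset.card_product, mul_comm]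

/-- `F` has at most `|code F|` literal occurrences. [folklore] -/
theorem length_flatten_le_length_cnfE (F : CNF ℕ) : F.flatten.length ≤ (cnfE F).length := by
  have hraw : ∀ G : CNF ℕ, G.flatten.length ≤ (rawE (listE litE) G).length := by
    intro G
    induction G with
    | nil => simp
    | cons c G ih =>
      rw [List.flatten_cons, List.length_append, rawE_cons, length_boolPair]
      have hc : c.length ≤ (listE litE c).length := by
        rw [listE, length_boolPair, length_unE]; omega
      omega
  have h := hraw F
  rw [cnfE, listE, length_boolPair]
  change F.flatten.length ≤ 2 * (unE F.length).length + 2 + (rawE (listE litE) F).length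
  omega

/-- `F` has at most `|code F|` variables. [folklore] -/
theorem card_vars_le (F : CNF ℕ) : F.vars.card ≤ (cnfE F).length :=
  ((List.toFinset_card_le _).trans (by rw [List.length_map])).trans (length_flatten_le_length_cnfE F)

/-- A variable of `F` has a short numeral: it occurs in the code of `F`. [folklore] -/
theorem length_natE_le_of_mem_vars {F : CNF ℕ} {v : ℕ} (hv : v ∈ F.vars) : (natE v).length ≤ (cnfE F).length := by
  simp only [CNF.vars, List.mem_toFinset, List.mem_map, List.mem_flatten] at hv
  obtain ⟨l, ⟨c, hc, hl⟩, rfl⟩ := hv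
  have h1 := length_item_le_length_rawE litE hl
  have h2 := length_item_le_length_rawE (listE litE) hc
  have h3 : (litE l).length = 2 * (natE l.1).length + 2 + 1 := by
    rw [show litE l = boolPair (natE l.1) (bitE l.2) from rfl, length_boolPair]; rfl
  have h4 : (listE litE c).length = 2 * c.length + 2 + (rawE litE c).length := by
    rw [listE, length_boolPair, length_unE]
  have h5 : (cnfE F).length = 2 * F.length + 2 + (rawE (listE litE) F).length := by
    rw [cnfE, listE, length_boolPair, length_unE]
  omega

/-- Indices named by a valid line are smaller than its position. [folklore] -/
theorem hdr_le_of_valid {F : CNF ℕ} {prev : List (ResLine ℕ)} {l : ResLine ℕ} (hv : IsValidResLine F prev l)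
    {N : ℕ} (hN : prev.length ≤ N) (h2 : 2 ≤ N) (hvars : ∀ v ∈ F.vars, (natE v).length ≤ N) :
    ∀ a ∈ (hdrOf (projR F l.rule)).map Prod.fst, (natE a).length ≤ N := by
  obtain ⟨C, r⟩ := l
  have h0 : (natE 0).length ≤ N := by rw [natE_zero]; exact Nat.zero_le _
  have h1 : (natE 1).length ≤ N := (length_natE_le 1).trans (by omega)
  have h2' : (natE 2).length ≤ N := (length_natE_le 2).trans h2
  intro a ha
  cases r with
  | initial =>
    simp only [hdrOf, projR, List.map_cons, List.map_nil, List.mem_cons, List.not_mem_nil, or_false] at ha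
    rcases ha with rfl | rfl | rfl | rfl <;> exact h0
  | weaken i =>
    obtain ⟨hi, -⟩ : ∃ hi : i < prev.length, (prev[i]).clause ⊆ C := hv
    have hi' : (natE i).length ≤ N := (length_natE_le i).trans (by omega)
    simp only [hdrOf, projR, List.map_cons, List.map_nil, List.mem_cons, List.not_mem_nil, or_false] at ha
    rcases ha with rfl | rfl | rfl | rfl <;> assumption
  | resolve i j v =>
    obtain ⟨hi, hj, -⟩ : ∃ (hi : i < prev.length) (hj : j < prev.length),
      IsResolvent (prev[i]).clause (prev[j]).clause v C := hv
    have hi' : (natE i).length ≤ N := (length_natE_le i).trans (by omega)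
    have hj' : (natE j).length ≤ N := (length_natE_le j).trans (by omega)
    by_cases hvar : v ∈ F.vars
    · have hv' := hvars v hvar
      simp only [hdrOf, projR, if_pos hvar, List.map_cons, List.map_nil, List.mem_cons, List.not_mem_nil, or_false] at ha
      rcases ha with rfl | rfl | rfl | rfl <;> assumption
    · simp only [hdrOf, projR, if_neg hvar, List.map_cons, List.map_nil, List.mem_cons, List.not_mem_nil, or_false] at ha
      rcases ha with rfl | rfl | rfl | rfl <;> assumption

/-- **The witness is short**: cubic in any `N ≥ 2` dominating `|π|`, `|code F|`.
[cite: AtseriasMuller2020, §1 (refutations of length s as NP witnesses)] -/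
theorem length_cnfE_witness_le {F : CNF ℕ} {π : List (ResLine ℕ)} (hπ : IsResDerivation F π) {N : ℕ}
    (h2 : 2 ≤ N) (hπN : π.length ≤ N) (hF : (cnfE F).length ≤ N) :
    (cnfE (witness F π)).length ≤
      2 * N + 2 + N * (2 * (2 * (2 * N + 4) + 2 + (2 * N + 4) * (2 * (2 * N + 3) + 2)) + 2) := by
  have hvars : ∀ v ∈ F.vars, (natE v).length ≤ N := fun v hv => (length_natE_le_of_mem_vars hv).trans hF
  -- every line code: at most `2N+4` literals, each of code length `≤ 2N+3`
  have hline : ∀ c ∈ witness F π, (listE litE c).length ≤ 2 * (2 * N + 4) + 2 + (2 * N + 4) * (2 * (2 * N + 3) + 2) := by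
    intro c hc
    simp only [witness, List.map_map, List.mem_map, Function.comp_apply] at hc
    obtain ⟨l, hl, rfl⟩ := hc
    obtain ⟨k, hk, rfl⟩ := List.getElem_of_mem hl
    have hlen : (encLine (projL F π[k])).length ≤ 2 * N + 4 := by
      rw [encLine, List.length_append, length_hdrOf, Finset.length_toList]
      have := (card_projC_le F (π[k]).clause).trans (Nat.mul_le_mul_left 2 ((card_vars_le F).trans hF))
      change 4 + (projC F (π[k]).clause).card ≤ 2 * N + 4
      omega
    have hlit : ∀ a ∈ encLine (projL F π[k]), (litE a).length ≤ 2 * N + 3 := by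
      intro a ha
      have hnat : (natE a.1).length ≤ N := by
        rw [encLine, List.mem_append] at ha
        rcases ha with ha | ha
        · exact hdr_le_of_valid (hπ k hk) ((List.length_take_le k π).trans (hk.le.trans hπN)) h2 hvars a.1
            (List.mem_map.2 ⟨a, ha, rfl⟩)
        · have ha' : a ∈ projC F (π[k]).clause := (Finset.mem_toList).1 ha
          exact hvars a.1 (Finset.mem_filter.1 ha').2
      rw [show litE a = boolPair (natE a.1) (bitE a.2) from rfl, length_boolPair]
      change 2 * (natE a.1).length + 2 + 1 ≤ 2 * N + 3
      omega
    have hraw := LMat.length_rawE_le_mul litE hlit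
    rw [listE, length_boolPair, length_unE]
    have : (encLine (projL F π[k])).length * (2 * (2 * N + 3) + 2) ≤ (2 * N + 4) * (2 * (2 * N + 3) + 2) :=
      Nat.mul_le_mul_right _ hlen
    omega
  have hraw := LMat.length_rawE_le_mul (listE litE) hline
  have hW : (witness F π).length ≤ N := by rw [witness, List.length_map, List.length_map]; exact hπN
  rw [cnfE, listE, length_boolPair, length_unE]
  change 2 * (witness F π).length + 2 + (rawE (listE litE) (witness F π)).length ≤ _
  have := Nat.mul_le_mul_right (2 * (2 * (2 * N + 4) + 2 + (2 * N + 4) * (2 * (2 * N + 3) + 2)) + 2) hW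
  omega

/-! ### The checker as a typed polynomial-time program -/


/-- `hdr` is polynomial-time. [cite: AroraBarak2009, §1.3] -/
theorem hdrFP (k : ℕ) : CodeFP (rawE litE) natE (fun c => hdr c k) :=
  ((rawGetD natE natE_zero).comp ((map₀ (fst natE bitE)).pair (const _ k))).congr fun _ => rfl

/-- `body` is polynomial-time. [cite: AroraBarak2009, §1.3] -/
theorem bodyFP : CodeFP (rawE litE) (rawE litE) body :=
  ((rawDropUn litE).comp ((const _ 4).pair (CodeFP.id _))).congr fun _ => rfl

/-- `subB` is polynomial-time. [cite: AroraBarak2009, §1.3] -/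
theorem subFP : CodeFP (pairE (rawE litE) (rawE litE)) bitE (fun p => subB p.1 p.2) :=
  ((all ((mem (pairE_injective natE_injective bitE_injective)).comp ((snd _ _).pair (fst _ _)))).comp ((snd _ _).pair (fst _ _))).congr
    fun _ => rfl

/-- `resStep` is polynomial-time. [cite: AroraBarak2009, §1.3] -/
theorem resStepFP :
    CodeFP (pairE (rawE litE) (pairE (rawE litE) natE)) (rawE litE) (fun t => resStep t.1 t.2.1 t.2.2) := by
  have hb : ∀ b : Bool, CodeFP (pairE natE litE) bitE (fun t => !decide (t.2 = (t.1, b))) := fun b =>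
    ((eq (pairE_injective natE_injective bitE_injective)).comp ((snd _ _).pair ((fst _ _).pair (const _ b)))).not
  have hv : CodeFP (pairE (rawE litE) (pairE (rawE litE) natE)) natE (fun t => t.2.2) := (snd _ _).snd'
  exact ((rawAppend litE).comp (((filter (hb true)).comp (hv.pair (fst _ _))).pair
    ((filter (hb false)).comp (hv.pair (snd _ _).fst')))).congr fun _ => rfl

/-- `initB` is polynomial-time. [cite: AroraBarak2009, §1.3] -/
theorem initFP : CodeFP (pairE (rawE (rawE litE)) (rawE litE)) bitE (fun p => initB p.1 p.2) :=
  ((any ((subFP.comp ((snd _ _).pair (fst _ _))).and subFP)).comp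
    ((bodyFP.comp (snd _ _)).pair (fst _ _))).congr fun _ => rfl

/-- `weakB` is polynomial-time. [cite: AroraBarak2009, §1.3] -/
theorem weakFP : CodeFP (pairE (rawE (rawE litE)) (rawE litE)) bitE (fun p => weakB p.1 p.2) := by
  have hi : CodeFP (pairE (rawE (rawE litE)) (rawE litE)) natE (fun p => hdr p.2 1) := (hdrFP 1).comp (snd _ _)
  have hget : CodeFP (pairE (rawE (rawE litE)) (rawE litE)) (rawE litE) (fun p => p.1.getD (hdr p.2 1) []) :=
    (rawGetD (rawE litE) (rawE_nil litE)).comp ((fst _ _).pair hi)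
  exact ((natLt.comp (hi.pair ((natLength _).comp (fst _ _)))).and
    (subFP.comp ((bodyFP.comp hget).pair (bodyFP.comp (snd _ _))))).congr fun _ => rfl

/-- `resB` is polynomial-time. [cite: AroraBarak2009, §1.3] -/
theorem resFP : CodeFP (pairE (rawE (rawE litE)) (rawE litE)) bitE (fun p => resB p.1 p.2) := by
  have hh : ∀ k, CodeFP (pairE (rawE (rawE litE)) (rawE litE)) natE (fun p => hdr p.2 k) := fun k =>
    (hdrFP k).comp (snd _ _)
  have hlen : CodeFP (pairE (rawE (rawE litE)) (rawE litE)) natE (fun p => p.1.length) := (natLength _).comp (fst _ _)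
  have hget : ∀ k, CodeFP (pairE (rawE (rawE litE)) (rawE litE)) (rawE litE)
      (fun p => body (p.1.getD (hdr p.2 k) [])) := fun k =>
    bodyFP.comp ((rawGetD (rawE litE) (rawE_nil litE)).comp ((fst _ _).pair (hh k)))
  have hlit : ∀ b : Bool, CodeFP (pairE (rawE (rawE litE)) (rawE litE)) litE (fun p => (hdr p.2 3, b)) := fun b =>
    (hh 3).pair (const _ b)
  have hRS := resStepFP.comp ((hget 1).pair ((hget 2).pair (hh 3)))
  exact ((natLt.comp ((hh 1).pair hlen)).and ((natLt.comp ((hh 2).pair hlen)).and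
    (((mem (pairE_injective natE_injective bitE_injective)).comp ((hlit true).pair (hget 1))).and (((mem (pairE_injective natE_injective bitE_injective)).comp
      ((hlit false).pair (hget 2))).and ((subFP.comp ((bodyFP.comp (snd _ _)).pair hRS)).and
        (subFP.comp (hRS.pair (bodyFP.comp (snd _ _))))))))).congr fun _ => rfl

/-- `validB` is polynomial-time. [cite: CookReckhow1979, Def. 1.4; AroraBarak2009, §1.3] -/
theorem validFP : CodeFP (pairE (rawE (rawE litE)) (pairE (rawE (rawE litE)) (rawE litE))) bitE
    (fun t => validB t.1 t.2.1 t.2.2) := by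
  have h0 : CodeFP (pairE (rawE (rawE litE)) (pairE (rawE (rawE litE)) (rawE litE))) natE (fun t => hdr t.2.2 0) :=
    (hdrFP 0).comp (snd _ _).snd'
  refine (((natEq.comp (h0.pair (const _ 1))).ite (resFP.comp (snd _ _))
    ((natEq.comp (h0.pair (const _ 2))).ite (weakFP.comp (snd _ _))
      (initFP.comp ((fst _ _).pair (snd _ _).snd')))).congr fun t => ?_)
  by_cases h1 : hdr t.2.2 0 = 1
  · simp [validB, h1]
  · by_cases h2 : hdr t.2.2 0 = 2
    · simp [validB, h2]
    · simp [validB, h1, h2]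

/-- `derivB` is polynomial-time (a prefix `take` per line). [cite: CookReckhow1979, Def. 1.4; AroraBarak2009, §1.3] -/
theorem derivFP : CodeFP (pairE (rawE (rawE litE)) (rawE (rawE litE))) bitE (fun p => derivB p.1 p.2) := by
  have hW : CodeFP (pairE (pairE (rawE (rawE litE)) (rawE (rawE litE))) (pairE natE (rawE litE))) (rawE (rawE litE))
      (fun t => t.1.2) := (fst _ _).snd'
  have hk : CodeFP (pairE (pairE (rawE (rawE litE)) (rawE (rawE litE))) (pairE natE (rawE litE))) natE
      (fun t => t.2.1) := (snd _ _).fst'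
  have htake := (rawTakeUn (rawE litE)).comp ((unOfNatMin.comp (((ulength _).comp hW).pair hk)).pair hW)
  have hP := validFP.comp ((fst _ _).fst'.pair (htake.pair (snd _ _).snd'))
  refine (((all hP).comp ((CodeFP.id _).pair ((rawEnum (rawE litE)).comp (snd _ _)))).congr fun p => ?_)
  change (((List.range p.2.length).zip p.2).all fun a =>
    validB p.1 (p.2.take (min a.1 p.2.length)) a.2) = derivB p.1 p.2
  unfold derivB
  congr 1
  funext a
  rw [show p.2.take (min a.1 p.2.length) = p.2.take a.1 from by rw [List.take_eq_take_iff]; omega]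

/-- **The checker `refB` is polynomial-time** (inputs: `F` and `W` as CNF codes, `s` in unary).
[cite: AtseriasMuller2020, §1; CookReckhow1979, Def. 1.4] -/
theorem refFP : CodeFP (pairE cnfE (pairE unE cnfE)) bitE (fun t => refB t.1 t.2.1 t.2.2) := by
  have hF : CodeFP (pairE cnfE (pairE unE cnfE)) (rawE (rawE litE)) (fun t => t.1) := rawClausesFP.comp (fst _ _)
  have hW : CodeFP (pairE cnfE (pairE unE cnfE)) (rawE (rawE litE)) (fun t => t.2.2) :=
    rawClausesFP.comp (snd _ _).snd'
  have hs : CodeFP (pairE cnfE (pairE unE cnfE)) natE (fun t => t.2.1) := natOfUn.comp (snd _ _).fst'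
  have hany := (any ((rawIsEmpty litE).comp (bodyFP.comp (snd (pairE cnfE (pairE unE cnfE)) _)))).comp
    ((CodeFP.id _).pair hW)
  exact ((natLe.comp (((natLength _).comp hW).pair hs)).and ((derivFP.comp (hF.pair hW)).and hany)).congr
    fun _ => rfl

/-! ### The verifier language -/

/-- **The verifier's bit** on `z = ⟨x, y⟩`: `x` is a pair code `⟨a, w⟩` whose first component is a
canonical CNF code, and the CNF read off `y` codes a refutation of that CNF with `≤ |w|` lines.
[cite: AtseriasMuller2020, §1 (guess and check a refutation of length s)] -/
def verB (z : List Bool) : Bool :=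
  decide (boolPair (fstF (fstF z)) (sndF (fstF z)) = fstF z) &&
    (decide (cnfE (NegCNF.decCNF (fstF (fstF z))) = fstF (fstF z)) &&
      refB (NegCNF.decCNF (fstF (fstF z))) (sndF (fstF z)).length (NegCNF.decCNF (sndF z)))

/-- The verifier's bit is polynomial-time. [cite: AtseriasMuller2020, §1; AroraBarak2009, §1.3] -/
theorem verFP : CodeFP strE bitE verB := by
  have hinj : Function.Injective strE := fun _ _ h => h
  have h1 : CodeFP strE strE fstF := ⟨fstF, fstF_mem_FP, fun _ => rfl⟩
  have h2 : CodeFP strE strE sndF := ⟨sndF, sndF_mem_FP, fun _ => rfl⟩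
  have hbp : CodeFP (pairE strE strE) strE (fun p => boolPair p.1 p.2) :=
    ⟨id, PolyTimeComputable.id _, fun _ => rfl⟩
  have hdec : CodeFP strE cnfE NegCNF.decCNF :=
    ⟨KSATRed.canonCNFFn, KSATRed.canonCNFFn_mem_FP, fun w => by rw [KSATRed.canonCNFFn_eq, cnfE_eq]; rfl⟩
  have hcode : CodeFP cnfE strE cnfE := ⟨id, PolyTimeComputable.id _, fun _ => rfl⟩
  have ha := h1.comp h1
  have hpair := (eq hinj).comp ((hbp.comp (ha.pair (h2.comp h1))).pair h1)
  have hcanon := (eq hinj).comp ((hcode.comp (hdec.comp ha)).pair ha)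
  have href := refFP.comp ((hdec.comp ha).pair ((strLength.comp (h2.comp h1)).pair (hdec.comp h2)))
  exact (hpair.and (hcanon.and href)).congr fun _ => rfl

/-- The verifier language. [cite: AtseriasMuller2020, §1] -/
def resVerLang : Language Bool := {z | verB z = true}

/-- **The verifier language is in `P`.** [cite: AtseriasMuller2020, §1; AroraBarakCC2009, Def. 1.13] -/
theorem resVerLang_mem_P : resVerLang ∈ Classes.P := by
  obtain ⟨g, hg, hgv⟩ := verFP
  refine mem_P_of_mem_FP hg resVerLang fun z => ⟨fun hz => ?_, fun hz => ?_⟩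
  · rw [show g z = bitE (verB z) from hgv z, show verB z = true from hz]; rfl
  · rw [show g z = bitE (verB z) from hgv z, Bool.eq_false_iff.2 hz]; rfl

/-- **`resVerLang` is a polynomial verifier for `RESBOUND`** with the cubic witness bound.
[cite: AtseriasMuller2020, §1 (Thm 1, membership in NP); CookReckhow1979, Def. 1.4] -/
theorem isPolyVerifierFor_resBound :
    IsPolyVerifierFor resVerLang
      (2 * Polynomial.X + 2 + Polynomial.X * (2 * (2 * (2 * Polynomial.X + 4) + 2 +
        (2 * Polynomial.X + 4) * (2 * (2 * Polynomial.X + 3) + 2)) + 2)) resBoundLang := by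
  intro x
  constructor
  · rintro ⟨F, w, rfl, π, hπ, hs⟩
    refine ⟨cnfE (witness F π), ?_, ?_⟩
    · have hN : (cnfE F).length ≤ (boolPair (encodingCNF.encode F) w).length ∧
          w.length ≤ (boolPair (encodingCNF.encode F) w).length ∧ 2 ≤ (boolPair (encodingCNF.encode F) w).length := by
        rw [length_boolPair, cnfE_eq]; omega
      refine (length_cnfE_witness_le hπ.1 hN.2.2 (hs.trans hN.2.1) hN.1).trans (le_of_eq ?_)
      simp [Polynomial.eval_add, Polynomial.eval_mul]
    · show verB _ = true
      have hdF : NegCNF.decCNF (cnfE F) = F := by rw [← cnfE_eq]; exact KSATRed.decCNF_encode F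
      have hdW : NegCNF.decCNF (cnfE (witness F π)) = witness F π := by
        rw [← cnfE_eq]; exact KSATRed.decCNF_encode _
      simp only [verB, fstF_boolPair, sndF_boolPair, cnfE_eq, hdF, hdW, decide_true, Bool.true_and]
      exact refB_witness hπ hs
  · rintro ⟨y, -, hy⟩
    have hv : verB (boolPair x y) = true := hy
    simp only [verB, fstF_boolPair, sndF_boolPair, Bool.and_eq_true, decide_eq_true_iff] at hv
    obtain ⟨hx, hcanon, href⟩ := hv
    obtain ⟨hπ, hs⟩ := (refB_eq_true_iff _ _ _).1 href
    refine ⟨NegCNF.decCNF (fstF x), sndF x, ?_, _, hπ, by rw [List.length_map]; exact hs⟩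
    rw [cnfE_eq, hcanon, hx]

end SoloResNP

open SoloResNP in
/-- **`RESBOUND ∈ NP`**: a refutation of length `≤ s` (projected onto the variables of `F`, coded as
a CNF-shaped witness of cubic length) is guessed and checked in polynomial time.
[cite: AtseriasMuller2020, §1 (Thm 1: the problem is in NP); CookReckhow1979, Def. 1.4] -/
theorem soloInformed_resBound_mem_NP : resBoundLang ∈ Nondeterministic.NP :=
  mem_NP_iff_verifier.2 ⟨resVerLang, resVerLang_mem_P, _, isPolyVerifierFor_resBound⟩

/-- **`RESBOUND` is NP-complete** (membership above, hardness `soloInformed_resBound_isNPHard` via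
`3SAT ≤ₚ RESBOUND` from the Atserias–Müller gadget). [cite: AtseriasMuller2020, Thm 1–2] -/
theorem soloInformed_resBound_isNPComplete : IsNPComplete resBoundLang :=
  ⟨soloInformed_resBound_mem_NP, soloInformed_resBound_isNPHard⟩

/-- **The proof-complexity face of the summit, unconditionally: `PneNP ↔ RESBOUND ∉ P`** —
`P ≠ NP` holds iff Resolution proof search (does `F` have a refutation with at most `s` lines,
`s` in unary) is not decidable in polynomial time. Both named hypotheses of the gen-8 statement
(`rrefGadget_polyTime`, `RESBOUND ∈ NP`) are now theorems of the tree.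
[cite: AtseriasMuller2020, Thm 1; AroraBarakCC2009, Thm 2.8] -/
theorem soloInformed_pneNP_iff_resBound : PneNP ↔ resBoundLang ∉ Classes.P :=
  soloInformed_pneNP_iff_resBound_not_mem_P_holds soloInformed_resBound_mem_NP

end Summit.PneNP.PneNP.Theorems
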